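/-
Copyright (c) 2026 the pub-hodgecm-mathlib formalisation cell (harness21).  Prover seat hodgecm-mathlib-LH4-p15 (g0), req620 Track A «(D-RAM) FOUR-FRAME» squad
((β₂) road (R-36) «PURE-CELL LEDGER»; β₂-BOARD HANDOFF-beta2cells v1 (LH4-p04 (g8)) §OPEN «hdich at shallow axis levels (p15 face)»; (AX-sh) = the `hdich` binder of
★ p862003 `F0P3cDyRamAxisColumnZero` (LH4-p12 (g8)) on the WHOLE axis column), 2026-09-04.
-/
import Summits.HodgeConjecture.HodgeConjecture.Theorems.F0P3cDyRamDepthScalar                 -- ★ p861454 (LH4-p16 (g0)): `ray_eq_valueSetMod_smul_xPlus`; brings ★ (L-lab-3) `valueSetMod_smul_xPlus`, ★ `valueSetMod_smul_xPlus_congr`, ★ refSkewScalar lemmas, ★ DEFS `IsOrd`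
import Summits.HodgeConjecture.HodgeConjecture.Theorems.F0P3cDyRamValueSetSkewLineCriterion    -- ★ (L-lab-8) (F0P3a lineage): `exists_skew_near_of_trace_deep`; brings ★ `WildQuadraticDatumTrace` (`v_add_map_le_exp`), ★ `WildQuadraticEisensteinFrame` coordinates, ★ `v_inv_varpi_pow_mul_le_one_iff`
import Summits.HodgeConjecture.HodgeConjecture.Theorems.F0P3cDyRamShellLineModel               -- ★ p861579 (LH4-p16 (g0)): `isOrd_mul` (orders are closed under multiplication)
import Summits.HodgeConjecture.HodgeConjecture.Theorems.F0P3cDyRamAxisLetterToolkit           -- ★ (this seat, (AX-sh) toolkit): skew gain, coordinates, `κ`-facts, expansion, depth trace, token readings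
import HarnessLib

/-!
# Crux `H413`, line LH4 «(D-RAM) FOUR-FRAME» — STAGE-1b, row (2), the (β₂) road (R-36), row (AX-sh): «THE LETTER OF AN AXIS VERTEX IS ONE CLASS — AT EVERY LEVEL» —
# the line-model estimates: on a UNIMODULAR line `Λ = x₀·𝒪_j` carrying the near-transvection shell `(ℓ₀, 2k)` of the block element, the thickened value set
# `{Tr_ρ(κ·(lam − jE u₀)·N_Θ ζ) : ζ ∈ 𝒪_j} + 𝔭^{m}` is `valueSetMod σ ϖ m (e • X₊)` for a `σ`-FIXED unit `e` — no depth hypothesis (deep AND shallow orders)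

Cell `hodgecm-mathlib` (D-0151), FLOOR 0, crux item H413 = `stmt-HodgeConjecture-24833`, route of record `HCCMUnconditional`; squad F0∕P3c∕LH4; lane
`--supports stmt-HodgeConjecture-24833 --as helper` (count-neutral; pays NO tier-0 row).  THEOREMS ONLY (no `def`, no instance, no notation, no `sorry`, default heartbeats);
★-only imports; states NO law; (β₂) stays a HYPOTHESIS.  DATUM-FREE over the line-model letters of ★ (C1) ∕ ★ DEFS `F0P3cDyRamToricCensusDefs` (`M ⊇ jE(E)`, `ρ` with
`Fix ρ = jE(E)`, `Θ` with `Θ ∘ jE = jE ∘ σ`, the integral generator `α` with `|α − ρα| = 1` — the lanes A (Unr-K) and B (RamK) — and the order `𝒪_j = {IsOrd ρ α (jE ϖ)^j ·}`),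
a complete sheet datum `IsRamifiedQuadraticDatum σ ϖ d t` on `E`, a precision `m` and a half square-level `k` tied to `d` by the six inequalities `hF1 … hF6` (at the letters of
record `m = m* = mstarOfRecord d`, `2k = m_c = mcOfRecord d` they all hold for `d ≥ 2`; the consumer ★-file `F0P3cDyRamAxisLetterOneClass` discharges them by `omega`).

WHY (HANDOFF-beta2cells v1 (LH4-p04 (g8), 61f6486f) §OPEN; LH4-p04 16:28:43Z «if ★ p861154 does not literally give the equality at shallow levels, the shallow branch becomes
LH4-p15's named row (AX-sh)»; LH4-p13 (g8) 16:24:27Z deep-order recipe ∕ ★ p862010).  ★ p862003 (AX-0) turns the vanishing of the axis cell difference into two per-cell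
hypotheses `hclean` (★ p861941) and `hdich` («on the clean `(ℓ₀, m_c)`-shell the `m*`-letter of the axis vertex is `valueSetMod σ ϖ m* (e • X₊)` for a `σ`-fixed unit `e`»).
★ p862010 settles `hdich` in the DEEP-ORDER regime `|lam − 1| ≤ |ϖ|^{m*}` by raw size; THIS FILE shows that ON THE AXIS the regime hypothesis is NOT NEEDED: the clean-shell
tokens and unimodularity force the letter to be one ray.  On the unimodular line `Λ = x₀·𝒪_j` (dual generator `Y = κ·ϖE^j(α − ρα)` a UNIT, `κ := h·N_Θ x₀`, so `|κ| = |ϖ|^{−j}`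
and `|Tr_ρ κ| ≤ 1`) the values are `V(ζ) = Tr_ρ(c·N_Θ ζ)`, `c = κμ`, `μ = lam − jE u₀`; writing `ζ = A + B·α` with `ρ`-fixed coordinates (`|B| ≤ |ϖ|^j`, ★ toolkit §2),
  `V(ζ) − AΘA·Tr_ρ(c) = BΘA·P + AΘB·P′ + BΘB·Q`,  `P = Tr_ρ(cα)`, `P′ = Tr_ρ(cΘα)`, `Q = Tr_ρ(c·αΘα)`  (★ toolkit §4),
and `P′ = −ΘP + Tr_ρ((c + Θc)Θα)` with `c + Θc = κ·((lam − 1)²∕lam − jE Tr_σ(u₀ − 1))` (`N_Θ lam = 1`).  Hence the cross term is `(X − ΘX) + O(ϖ^{2k})`, `X = BΘA·P`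
`ρ`-fixed with `|X| ≤ |μ| ≤ |ϖ|^{k}`, and THE SKEW GAIN of the ramified datum (★ toolkit §1: `|x − σx| ≤ |x|·|ϖ|^{d−1}`) puts it in `𝔭^{k + d − 1} ⊆ 𝔭^{m}`; the `BΘB·Q` term dies
because the LOWER token forces `j ≥ k − ℓ₀` (§4).  So the letter is the thickened ray of the scalar `S = Tr_ρ(κμ)` (§2: `|S| = |ϖ|^{ℓ₀}` by the lower token and
`|Tr_ρ(κα)| = |κ|`; `S + ΘS ∈ 𝔭^{2k}` by the square token and `Tr 𝔭^{m} ⊆ 𝔭_F^{k}`), and ★ `exists_skew_near_of_trace_deep` (`m + d ≤ 2k + 1`) replaces `S∕t₊` by a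
`σ`-FIXED unit without moving the class (★ `valueSetMod_smul_xPlus_congr`).  MODEL CHECK (squad bus 2026-09-04 22:4xZ, `F0/P3c/LH4/LH4-p15/g0/axis_experiment.v1.LH4p15g0.py`):
at `E = ℚ₂(i)`, `d = 2`, 55 keys incl. the shallow keys `v(μ) = 2 < m* = 3`, every populated axis member is `+` or `−′`, none «neither».
* §1 `v_value_sub_ray_le` — every value is `ϖ^{m}`-close to its ray value (the expansion ★ `value_sub_ray_eq`, the SKEW GAIN ★ `v_sub_map_le_mul_of_fixed`, the depth
  trace ★ `depth_add_map_eq`, the token readings — all in ★ `F0P3cDyRamAxisLetterToolkit`).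
* §2 the scalar: `v_trace_depth_eq` (`|S| = |ϖ|^{ℓ₀}`), `v_trace_depth_add_map_le` (`S + ΘS ∈ 𝔭^{2k}`).
* §3 HEAD `exists_fixed_unit_lineValueSet_axis_eq_smul_xPlus`.
HONEST LABEL.  Count-neutral line-model algebra; nothing printed is asserted; no census law is stated; (β₂) and the typed letters stay HYPOTHESES; `HC_CM` is proved only
modulo the 7 printed citations (2 remaining named inputs: hLiu418 = `stmt-HodgeConjecture-24832`, h413 = `stmt-HodgeConjecture-24833`) until rung 0 closes.
## References
* [Serre1979] J.-P. Serre, *Local Fields*, GTM 67 (1979): Ch. III §3 Prop. 7 (trace images `Tr 𝔭_E^m = 𝔭_F^{⌊(m+d)∕2⌋}`), Ch. III §6 Prop. 12–13 (orders; the different of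
  a ramified quadratic extension), Ch. V §3 Cor. 3 (norm classes of units).
* [Jacobowitz1962] R. Jacobowitz, *Hermitian forms over local fields*, Amer. J. Math. 84 (1962): §4 (unimodular hermitian lines over an order of the quadratic extension).
* [Rogawski1990] J. D. Rogawski, *Automorphic Representations of Unitary Groups in Three Variables*, Ann. of Math. Stud. 123 (1990): §4.9 Prop. 4.9.1 (b) p. 55.
* [Kottwitz1986BaseChangeUnits] R. E. Kottwitz, *Base change for unit elements of Hecke algebras*, Compositio Math. 60 (1986): §1 pp. 240–241.
-/

set_option autoImplicit false

noncomputable section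

namespace Summit.HodgeConjecture.HodgeConjecture.Cruxes.H413.F0P3cDyRamAxisLetterEstimates

open scoped Valued WithZero
open WithZero
open Literature.NumberTheory.Automorphic.UnitaryThreeFourFrame (IsRamifiedQuadraticDatum)
open Literature.NumberTheory.LocalFields.WildQuadraticDatum
open Summit.HodgeConjecture.HodgeConjecture.Cruxes.H413.F0P3cDyRamFourFramePieces
open Summit.HodgeConjecture.HodgeConjecture.Cruxes.H413.F0P3cDyRamToricCensusDefs
open Summit.HodgeConjecture.HodgeConjecture.Cruxes.H413.F0P3cDyRamShellLabelPlus (v_inv_varpi_pow_mul_le_one_iff)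
open Summit.HodgeConjecture.HodgeConjecture.Cruxes.H413.F0P3cDyRamFrameEltOneSlotLabel (valueSetMod_smul_xPlus_congr)
open Summit.HodgeConjecture.HodgeConjecture.Cruxes.H413.F0P3cDyRamValueSetSkewLineCriterion (exists_skew_near_of_trace_deep)
open Summit.HodgeConjecture.HodgeConjecture.Cruxes.H413.F0P3cDyRamDepthScalar (ray_eq_valueSetMod_smul_xPlus)
open Summit.HodgeConjecture.HodgeConjecture.Cruxes.H413.F0P3cDyRamShellLineModel (isOrd_mul)
open Summit.HodgeConjecture.HodgeConjecture.Cruxes.H413.F0P3cDyRamAxisLetterToolkit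

section LineModel

variable {E : Type} {M : Type*} [Field E] [Valued E ℤᵐ⁰] [Field M] [Valued M ℤᵐ⁰] {σ : E →+* E} {ϖ : E} {d t : ℕ} {ρ Θ : M →+* M} {α : M}

/-! ## §1 Every value is `ϖ^m`-close to its ray value -/

/-- **EVERY VALUE IS `ϖ^m`-CLOSE TO ITS RAY VALUE.**  Frame: the line model with `|α − ρα| = 1`, the `κ` of a unimodular line at order level `j` (`Θκ = κ`,
`|κ|·|jE ϖ|^j = 1`), the block element `(lam, u₀)` with `Θlam·lam = 1`, `|u₀ − 1| ≤ |ϖ^m|`, and the shell tokens read in the line model — level `ℓ₀ = d % 2`, NOT level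
`ℓ₀ + 1`, square level `2k` — with `hF1 : m ≤ k + d − 1`, `hF2 : k ≤ m`, `hF3 : m + ℓ₀ ≤ 2k`, `hF4 : ℓ₀ + 1 ≤ k`, `hF6 : 2k ≤ m + d`.  THEN for every `ζ ∈ 𝒪_j` with
`ρ`-fixed coordinate `A`: `|Tr_ρ(c·ζΘζ) − AΘA·Tr_ρ(c)| ≤ exp(−m)`, `c = κ·(lam − jE u₀)` — the cross term by the SKEW GAIN (§1) and the depth trace, the `α`-square term by the
lower token. [cite: Jacobowitz1962, §4] [cite: Serre1979, Ch. III §3 Prop. 7, §6 Prop. 13] [cite: Rogawski1990, §4.9 Prop. 4.9.1 (b) p. 55] -/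
theorem v_value_sub_ray_le (hD : IsRamifiedQuadraticDatum σ ϖ d t) (jE : E →+* M) (hjiso : ∀ a, Valued.v (jE a) = Valued.v a)
    (hjfix : ∀ z, ρ z = z ↔ ∃ c, jE c = z) (hΘj : ∀ x, Θ (jE x) = jE (σ x))
    (hρρ : ∀ x, ρ (ρ x) = x) (hvρ : ∀ x, Valued.v (ρ x) = Valued.v x) (hΘΘ : ∀ x, Θ (Θ x) = x) (hΘρ : ∀ x, Θ (ρ x) = ρ (Θ x))
    (hvΘ : ∀ x, Valued.v (Θ x) = Valued.v x) (hα1 : Valued.v α ≤ 1) (hαρ : Valued.v (α - ρ α) = 1)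
    {κ : M} (hΘκ : Θ κ = κ) {j : ℕ} (hκj : Valued.v κ * Valued.v (jE ϖ) ^ j = 1)
    {lam : M} (hlam : Θ lam * lam = 1) {u₀ : E} {m k : ℕ} (hum : Valued.v (u₀ - 1) ≤ Valued.v (ϖ ^ m))
    (hnlev : ¬ IsOrd ρ α (jE ϖ ^ j) ((lam - 1) / jE ϖ ^ (d % 2 + 1))) (hsq : IsOrd ρ α (jE ϖ ^ j) ((lam - 1) ^ 2 / jE ϖ ^ (2 * k)))
    (hF1 : m ≤ k + d - 1) (hF2 : k ≤ m) (hF3 : m + d % 2 ≤ 2 * k) (hF4 : d % 2 + 1 ≤ k) (hF6 : 2 * k ≤ m + d)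
    {ζ : M} (hζ : IsOrd ρ α (jE ϖ ^ j) ζ) :
    Valued.v ((κ * (lam - jE u₀) * ((ζ * Θ ζ)) + ρ (κ * (lam - jE u₀) * (ζ * Θ ζ))) -
        (ζ - (ζ - ρ ζ) / (α - ρ α) * α) * Θ (ζ - (ζ - ρ ζ) / (α - ρ α) * α) * (κ * (lam - jE u₀) + ρ (κ * (lam - jE u₀)))) ≤ exp (-(m : ℤ)) := by
  obtain ⟨hσ, hvσ, hϖ, hfix, hd, h1d, ht⟩ := hD
  have hα : ρ α ≠ α := fun h => by rw [h, sub_self, map_zero] at hαρ; exact zero_ne_one hαρ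
  -- sizes of the letters
  have hq : Valued.v (jE ϖ) = exp (-1 : ℤ) := by rw [hjiso, hϖ]
  have hcc : Valued.v (jE ϖ ^ j) = exp (-(j : ℤ)) := v_map_varpi_pow hϖ jE hjiso j
  have hcc1 : Valued.v (jE ϖ ^ j) ≤ 1 := by rw [hcc, ← exp_zero, exp_le_exp]; omega
  have hκ : Valued.v κ = exp (j : ℤ) := v_kappa_eq hϖ jE hjiso hκj
  have hw : Valued.v (lam - 1) ≤ exp (-(k : ℤ)) := v_sub_one_le_of_sq hϖ jE hjiso hsq
  have hμ : Valued.v (lam - jE u₀) ≤ exp (-(k : ℤ)) := v_depth_le hϖ jE hjiso hw hum hF2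
  have hl1 : Valued.v lam = 1 := v_lam_eq_one hvΘ hlam
  have hl0 : lam ≠ 0 := fun h0 => by rw [h0, map_zero] at hl1; exact zero_ne_one hl1
  obtain ⟨-, hkj⟩ := lower_token_read hϖ jE hjiso hjfix hvρ hαρ hw hF4 hnlev
  set μ : M := lam - jE u₀ with hμdef
  set c : M := κ * μ with hcdef
  have hc : Valued.v c ≤ exp ((j : ℤ) - k) := by
    rw [hcdef, map_mul, hκ, sub_eq_add_neg, exp_add]; exact mul_le_mul' le_rfl hμ
  -- the coordinates of `ζ`
  obtain ⟨hB, hA⟩ := coords_fixed hρρ hα ζ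
  obtain ⟨hB1, hA1⟩ := v_coords_le hα hα1 hcc1 hζ
  set B : M := (ζ - ρ ζ) / (α - ρ α) with hBdef
  set A : M := ζ - B * α with hAdef
  have hζAB : ζ = A + B * α := by simp [A]
  have hA' : ρ (Θ A) = Θ A := by rw [← hΘρ, hA]
  have hB' : ρ (Θ B) = Θ B := by rw [← hΘρ, hB]
  have hBj : Valued.v B ≤ exp (-(j : ℤ)) := hcc ▸ hB1
  -- the expansion
  have hexp := value_sub_ray_eq (Θ := Θ) (α := α) hA hB hA' hB' c
  rw [← hζAB] at hexp
  rw [hexp]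
  -- the three traces
  set P : M := c * α + ρ (c * α) with hPdef
  set P' : M := c * Θ α + ρ (c * Θ α) with hP'def
  set Q : M := c * (α * Θ α) + ρ (c * (α * Θ α)) with hQdef
  have hP : Valued.v P ≤ exp ((j : ℤ) - k) := (v_add_map_le hvρ _).trans (by rw [Valuation.map_mul _ c]; exact (mul_le_of_le_one_right' hα1).trans hc)
  have hΘα1 : Valued.v (Θ α) ≤ 1 := by rw [hvΘ]; exact hα1
  have hQ : Valued.v Q ≤ exp ((j : ℤ) - k) :=
    (v_add_map_le hvρ _).trans (by rw [Valuation.map_mul _ c, Valuation.map_mul _ α]; exact (mul_le_of_le_one_right' (mul_le_one' hα1 hΘα1)).trans hc)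
  -- regroup the cross term: `X − ΘX` with `X = BΘA·P`, plus `AΘB·(P′ + ΘP)`
  have hΘX : Θ (B * Θ A * P) = Θ B * A * Θ P := by rw [map_mul, map_mul, hΘΘ]
  rw [cross_regroup A B (Θ A) (Θ B) P P' (Θ P), ← hΘX]
  -- (i) the skew gain on `X`
  have hXfix : ρ (B * Θ A * P) = B * Θ A * P := by rw [map_mul, map_mul, hB, hA', hPdef, map_add_map_eq hρρ]
  have hX : Valued.v (B * Θ A * P) ≤ exp (-(k : ℤ)) := by
    rw [map_mul, map_mul, hvΘ]
    calc Valued.v B * Valued.v A * Valued.v P ≤ exp (-(j : ℤ)) * 1 * exp ((j : ℤ) - k) := mul_le_mul' (mul_le_mul' hBj hA1) hP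
      _ = exp (-(k : ℤ)) := by rw [mul_one, ← exp_add]; congr 1; ring
  have hi : Valued.v (B * Θ A * P - Θ (B * Θ A * P)) ≤ exp (-(m : ℤ)) := by
    refine (v_sub_map_le_mul_of_fixed ⟨hσ, hvσ, hϖ, hfix, hd, h1d, ht⟩ jE hjiso hjfix hΘj hXfix).trans ?_
    rw [hq, ← exp_nsmul, nsmul_eq_mul]
    refine (mul_le_mul' hX le_rfl).trans ?_
    rw [← exp_add, exp_le_exp]
    have : ((d - 1 : ℕ) : ℤ) = (d : ℤ) - 1 := by omega
    rw [this]; omega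
  -- (ii) the depth trace on `AΘB·(P′ + ΘP)`
  have hsum : P' + Θ P = (c + Θ c) * Θ α + ρ ((c + Θ c) * Θ α) := by
    rw [hP'def, hPdef, map_trace_mul_eq hΘρ c α, sum_traces_eq]
  have hcΘc : Valued.v (c + Θ c) ≤ exp ((j : ℤ) - 2 * k) := by
    rw [hcdef, hμdef, depth_add_map_eq jE hΘj hΘκ hlam u₀, map_mul, hκ,
      show (j : ℤ) - 2 * k = j + -(2 * k) by ring, exp_add]
    refine mul_le_mul' le_rfl ((Valuation.map_sub _ _ _).trans (max_le ?_ ?_))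
    · rw [map_mul, map_inv₀, hl1, inv_one, mul_one, map_pow, pow_two, show -(2 * (k : ℤ)) = -(k : ℤ) + -(k : ℤ) by ring, exp_add]
      exact mul_le_mul' hw hw
    · rw [hjiso]
      have hu : Valued.v (u₀ - 1) ≤ exp (-(m : ℤ)) := by rw [map_pow, v_varpi_pow hϖ] at hum; exact hum
      exact v_add_map_le_exp hσ hfix hϖ hd ht hu (m := k) (by omega)
  have hii : Valued.v (A * Θ B * (P' + Θ P)) ≤ exp (-(m : ℤ)) := by
    rw [hsum, map_mul, map_mul, hvΘ]
    have hT : Valued.v ((c + Θ c) * Θ α + ρ ((c + Θ c) * Θ α)) ≤ exp ((j : ℤ) - 2 * k) :=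
      (v_add_map_le hvρ _).trans (by rw [map_mul]; exact (mul_le_of_le_one_right' hΘα1).trans hcΘc)
    calc Valued.v A * Valued.v B * Valued.v ((c + Θ c) * Θ α + ρ ((c + Θ c) * Θ α))
        ≤ 1 * exp (-(j : ℤ)) * exp ((j : ℤ) - 2 * k) := mul_le_mul' (mul_le_mul' hA1 hBj) hT
      _ ≤ exp (-(m : ℤ)) := by rw [one_mul, ← exp_add, exp_le_exp]; omega
  -- (iii) the `α`-square term by the lower token (`k ≤ j + ℓ₀`)
  have hiii : Valued.v (B * Θ B * Q) ≤ exp (-(m : ℤ)) := by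
    rw [map_mul, map_mul, hvΘ]
    calc Valued.v B * Valued.v B * Valued.v Q ≤ exp (-(j : ℤ)) * exp (-(j : ℤ)) * exp ((j : ℤ) - k) := mul_le_mul' (mul_le_mul' hBj hBj) hQ
      _ ≤ exp (-(m : ℤ)) := by rw [← exp_add, ← exp_add, exp_le_exp]; omega
  -- assemble
  refine (Valuation.map_add _ _ _).trans (max_le ((Valuation.map_add _ _ _).trans (max_le hi hii)) hiii)

/-! ## §2 The scalar `S = Tr_ρ(κ·(lam − jE u₀))`: `|S| = |ϖ|^{ℓ₀}` and `S + ΘS ∈ 𝔭^{2k}` -/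

/-- **`|S| = exp(−ℓ₀)`**, `S = Tr_ρ(κμ)`: in the coordinates `μ = A_μ + B_μ·α` one has `S = A_μ·Tr_ρ κ + B_μ·Tr_ρ(κα)` with `|B_μ| = |μ − ρμ| = exp(−(ℓ₀ + j))` EXACTLY
(level token `≤`, lower token `>`), `|Tr_ρ(κα)| = |κ| = exp(j)`, and `|A_μ·Tr_ρ κ| ≤ |A_μ| < exp(−ℓ₀)`. [cite: Jacobowitz1962, §4] [cite: Kottwitz1986BaseChangeUnits, §1 pp. 240–241] -/
theorem v_trace_depth_eq (hD : IsRamifiedQuadraticDatum σ ϖ d t) (jE : E →+* M) (hjiso : ∀ a, Valued.v (jE a) = Valued.v a)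
    (hjfix : ∀ z, ρ z = z ↔ ∃ c, jE c = z)
    (hρρ : ∀ x, ρ (ρ x) = x) (hvρ : ∀ x, Valued.v (ρ x) = Valued.v x)
    (hα1 : Valued.v α ≤ 1) (hαρ : Valued.v (α - ρ α) = 1)
    {κ : M} (hκρ : Valued.v (κ + ρ κ) ≤ 1) {j : ℕ} (hκj : Valued.v κ * Valued.v (jE ϖ) ^ j = 1)
    (lam : M) {u₀ : E} {m k : ℕ} (hum : Valued.v (u₀ - 1) ≤ Valued.v (ϖ ^ m))
    (hlev : IsOrd ρ α (jE ϖ ^ j) ((lam - 1) / jE ϖ ^ (d % 2))) (hnlev : ¬ IsOrd ρ α (jE ϖ ^ j) ((lam - 1) / jE ϖ ^ (d % 2 + 1)))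
    (hsq : IsOrd ρ α (jE ϖ ^ j) ((lam - 1) ^ 2 / jE ϖ ^ (2 * k))) (hF2 : k ≤ m) (hF4 : d % 2 + 1 ≤ k) :
    Valued.v (κ * (lam - jE u₀) + ρ (κ * (lam - jE u₀))) = exp (-((d % 2 : ℕ) : ℤ)) := by
  obtain ⟨hσ, hvσ, hϖ, hfix, hd, h1d, ht⟩ := hD
  have hα : ρ α ≠ α := fun h => by rw [h, sub_self, map_zero] at hαρ; exact zero_ne_one hαρ
  have hκ : Valued.v κ = exp (j : ℤ) := v_kappa_eq hϖ jE hjiso hκj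
  have hw : Valued.v (lam - 1) ≤ exp (-(k : ℤ)) := v_sub_one_le_of_sq hϖ jE hjiso hsq
  have hμ : Valued.v (lam - jE u₀) ≤ exp (-(k : ℤ)) := v_depth_le hϖ jE hjiso hw hum hF2
  obtain ⟨hlow, hkj⟩ := lower_token_read hϖ jE hjiso hjfix hvρ hαρ hw hF4 hnlev
  have hup := v_sub_map_le_of_isOrd hϖ jE hjiso hjfix hαρ hlev
  set μ : M := lam - jE u₀ with hμdef
  -- `μ − ρμ = (lam − 1) − ρ(lam − 1)`
  have hμρ : μ - ρ μ = (lam - 1) - ρ (lam - 1) := by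
    rw [hμdef, map_sub, map_sub, (hjfix _).2 ⟨u₀, rfl⟩, map_one]; ring
  -- coordinates of `μ`
  obtain ⟨hB, hA⟩ := coords_fixed hρρ hα μ
  set B : M := (μ - ρ μ) / (α - ρ α) with hBdef
  set A : M := μ - B * α with hAdef
  have hμAB : μ = A + B * α := by simp [A]
  have hvB : Valued.v B = exp (-(((d % 2 : ℕ) : ℤ) + j)) := by
    rw [hBdef, map_div₀, hαρ, div_one, hμρ]
    have h2 : Valued.v ((lam - 1) - ρ (lam - 1)) ≤ exp (-(((d % 2 : ℕ) : ℤ) + 1 + j) + 1) := by convert hup using 2; ring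
    convert eq_exp_of_lt_of_le hlow h2 using 2; ring
  have hj1 : 1 < Valued.v κ := by rw [hκ, ← exp_zero, exp_lt_exp]; omega
  have hbig : Valued.v (B * (κ * α + ρ (κ * α))) = exp (-((d % 2 : ℕ) : ℤ)) := by
    rw [map_mul, v_trace_mul_alpha_eq hvρ hα1 hαρ hκρ hj1, hvB, hκ, ← exp_add]; congr 1; ring
  have hAle : Valued.v A < exp (-((d % 2 : ℕ) : ℤ)) := by
    refine lt_of_le_of_lt (Valuation.map_sub _ _ _) (max_lt (lt_of_le_of_lt hμ ?_) ?_)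
    · rw [exp_lt_exp]; omega
    · rw [map_mul, hvB]
      refine lt_of_le_of_lt (mul_le_of_le_one_right' hα1) ?_
      rw [exp_lt_exp]; omega
  have hsmall : Valued.v (A * (κ + ρ κ)) < Valued.v (B * (κ * α + ρ (κ * α))) := by
    rw [hbig, map_mul]; exact lt_of_le_of_lt (mul_le_of_le_one_right' hκρ) hAle
  have e : κ * μ + ρ (κ * μ) = B * (κ * α + ρ (κ * α)) + A * (κ + ρ κ) := by
    rw [hμAB, map_mul, map_add, map_mul, hA, hB, map_mul]; ring
  rw [e, Valuation.map_add_eq_of_lt_left _ hsmall, hbig]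

/-- **`S + ΘS ∈ 𝔭^{2k}`**: `S + ΘS = Tr_ρ(c + Θc) = Tr_ρ(κ(lam − 1)²lam⁻¹) − Tr_σ(u₀ − 1)·Tr_ρ κ`; the first trace is `ϖE^{2k}·Tr_ρ(κζ₂)` with
`ζ₂ = ((lam − 1)²∕ϖE^{2k})·lam⁻¹ ∈ 𝒪_j` (square token; `lam⁻¹ ∈ 𝒪_j` since `|lam − ρlam| ≤ exp(−j)`), integral by §3; the second is `≤ exp(−2k)` by `Tr 𝔭^m ⊆ 𝔭_F^{k}`
(★ `v_add_map_le_exp`, `2k ≤ m + d`). [cite: Serre1979, Ch. III §3 Prop. 7] [cite: Jacobowitz1962, §4] -/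
theorem v_trace_depth_add_map_le (hD : IsRamifiedQuadraticDatum σ ϖ d t) (jE : E →+* M) (hjiso : ∀ a, Valued.v (jE a) = Valued.v a)
    (hjfix : ∀ z, ρ z = z ↔ ∃ c, jE c = z) (hΘj : ∀ x, Θ (jE x) = jE (σ x))
    (hρρ : ∀ x, ρ (ρ x) = x) (hvρ : ∀ x, Valued.v (ρ x) = Valued.v x) (hΘρ : ∀ x, Θ (ρ x) = ρ (Θ x)) (hvΘ : ∀ x, Valued.v (Θ x) = Valued.v x)
    (hα1 : Valued.v α ≤ 1) (hαρ : Valued.v (α - ρ α) = 1)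
    {κ : M} (hΘκ : Θ κ = κ) (hκρ : Valued.v (κ + ρ κ) ≤ 1) {j : ℕ} (hκj : Valued.v κ * Valued.v (jE ϖ) ^ j = 1)
    {lam : M} (hlam : Θ lam * lam = 1) {u₀ : E} {m k : ℕ} (hum : Valued.v (u₀ - 1) ≤ Valued.v (ϖ ^ m))
    (hlev : IsOrd ρ α (jE ϖ ^ j) ((lam - 1) / jE ϖ ^ (d % 2))) (hsq : IsOrd ρ α (jE ϖ ^ j) ((lam - 1) ^ 2 / jE ϖ ^ (2 * k))) (hF6 : 2 * k ≤ m + d) :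
    Valued.v ((κ * (lam - jE u₀) + ρ (κ * (lam - jE u₀))) + Θ (κ * (lam - jE u₀) + ρ (κ * (lam - jE u₀)))) ≤ exp (-(2 * (k : ℤ))) := by
  obtain ⟨hσ, hvσ, hϖ, hfix, hd, h1d, ht⟩ := hD
  have hα : ρ α ≠ α := fun h => by rw [h, sub_self, map_zero] at hαρ; exact zero_ne_one hαρ
  have hcc : Valued.v (jE ϖ ^ j) = exp (-(j : ℤ)) := v_map_varpi_pow hϖ jE hjiso j
  have hcc1 : Valued.v (jE ϖ ^ j) ≤ 1 := by rw [hcc, ← exp_zero, exp_le_exp]; omega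
  have hκ : Valued.v κ = exp (j : ℤ) := v_kappa_eq hϖ jE hjiso hκj
  have hκcc : Valued.v κ * Valued.v (jE ϖ ^ j) ≤ 1 := by rw [hκ, hcc, ← exp_add]; simp
  have hl1 : Valued.v lam = 1 := v_lam_eq_one hvΘ hlam
  have hl0 : lam ≠ 0 := fun h0 => by rw [h0, map_zero] at hl1; exact zero_ne_one hl1
  have h2k : Valued.v (jE ϖ ^ (2 * k)) = exp (-(2 * (k : ℤ))) := by rw [v_map_varpi_pow hϖ jE hjiso]; push_cast; ring_nf
  have h2k0 : jE ϖ ^ (2 * k) ≠ 0 := fun h0 => by rw [h0, map_zero] at h2k; exact exp_ne_zero h2k.symm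
  have hρϖ : ρ (jE ϖ) = jE ϖ := (hjfix _).2 ⟨ϖ, rfl⟩
  have hρ2k : ρ (jE ϖ ^ (2 * k)) = jE ϖ ^ (2 * k) := by rw [map_pow, (hjfix _).2 ⟨ϖ, rfl⟩]
  -- `lam⁻¹ ∈ 𝒪_j`
  have hup := v_sub_map_le_of_isOrd hϖ jE hjiso hjfix hαρ hlev
  have hlaminv : IsOrd ρ α (jE ϖ ^ j) lam⁻¹ := by
    rw [isOrd_iff, map_inv₀, hl1, inv_one]
    refine ⟨le_rfl, ?_⟩
    have e : lam⁻¹ - ρ lam⁻¹ = -(((lam - 1) - ρ (lam - 1)) / (lam * ρ lam)) := by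
      rw [map_inv₀, map_sub, map_one]
      have hρl0 : ρ lam ≠ 0 := (map_ne_zero ρ).2 hl0
      field_simp
      ring
    rw [e, Valuation.map_neg, map_div₀, map_mul, hvρ, hl1, mul_one, div_one, map_mul, hαρ, mul_one, hcc]
    refine hup.trans ?_
    rw [exp_le_exp]; omega
  -- `Tr_ρ(c + Θc)` in two pieces
  have e1 : κ * (lam - jE u₀) + ρ (κ * (lam - jE u₀)) + Θ (κ * (lam - jE u₀) + ρ (κ * (lam - jE u₀))) =
      (κ * (lam - jE u₀) + Θ (κ * (lam - jE u₀))) + ρ (κ * (lam - jE u₀) + Θ (κ * (lam - jE u₀))) := by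
    rw [map_add Θ, hΘρ, map_add ρ]; ring
  rw [e1, depth_add_map_eq jE hΘj hΘκ hlam u₀, mul_sub, map_sub ρ]
  have esplit : κ * ((lam - 1) ^ 2 * lam⁻¹) - κ * jE ((u₀ - 1) + σ (u₀ - 1)) + (ρ (κ * ((lam - 1) ^ 2 * lam⁻¹)) - ρ (κ * jE ((u₀ - 1) + σ (u₀ - 1)))) =
      jE ϖ ^ (2 * k) * (κ * ((lam - 1) ^ 2 / jE ϖ ^ (2 * k) * lam⁻¹) + ρ (κ * ((lam - 1) ^ 2 / jE ϖ ^ (2 * k) * lam⁻¹))) -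
        jE ((u₀ - 1) + σ (u₀ - 1)) * (κ + ρ κ) := by
    have hρjE : ∀ x, ρ (jE x) = jE x := fun x => (hjfix _).2 ⟨x, rfl⟩
    simp only [map_mul, map_div₀, map_pow, map_inv₀, map_sub, map_one, hρjE]
    field_simp
    ring
  rw [esplit]
  refine (Valuation.map_sub _ _ _).trans (max_le ?_ ?_)
  · rw [map_mul, h2k]
    refine (mul_le_mul' le_rfl (v_trace_mul_le_one_of_isOrd hρρ hvρ hα hα1 hcc1 hκρ hκcc (isOrd_mul hvρ hsq hlaminv))).trans ?_
    rw [mul_one]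
  · rw [map_mul, hjiso]
    have hu : Valued.v (u₀ - 1) ≤ exp (-(m : ℤ)) := by rw [map_pow, v_varpi_pow hϖ] at hum; exact hum
    refine (mul_le_mul' (v_add_map_le_exp hσ hfix hϖ hd ht hu (m := k) (by omega)) hκρ).trans ?_
    rw [mul_one]

/-! ## §3 HEAD — the axis letter is one class, with a `σ`-fixed unit scalar -/

/-- **HEAD — (AX-sh) «THE LETTER OF A UNIMODULAR AXIS LINE ON THE CLEAN SHELL IS ONE CLASS, AT EVERY ORDER LEVEL `j`».**  Frame as in `v_value_sub_ray_le` (complete sheet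
datum on `E`, the line model with `|α − ρα| = 1`, the `κ` of a unimodular line at level `j`, a block element `(lam, u₀)` with `Θlam·lam = 1`, `|u₀ − 1| ≤ |ϖ^m|`, the three
shell tokens read in the line model — level `d % 2`, not level `d % 2 + 1`, square level `2k` — and the arithmetic `hF1 … hF6`, all true at `m = mstarOfRecord d`,
`2k = mcOfRecord d`, `d ≥ 2`).  THEN there is a `σ`-FIXED UNIT `e ∈ E` with
`{z ∣ ∃ ζ ∈ 𝒪_j, |(jE ϖ^m)⁻¹(jE z − Tr_ρ(κ(lam − jE u₀)·ζΘζ))| ≤ 1} = valueSetMod σ ϖ m (e • xPlus σ ϖ d)`: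
the letter is the thickened ray of `S = Tr_ρ(κ(lam − jE u₀))` (§4), `= valueSetMod σ ϖ m ((s·t₊⁻¹) • X₊)` for `jE s = S` (★ `ray_eq_valueSetMod_smul_xPlus`), and `s` is
`ϖ^m`-close to a skew `z′` (§5 + ★ `exists_skew_near_of_trace_deep`), so `e := z′·t₊⁻¹` is `σ`-fixed, a unit (`|s| = |t₊| = |ϖ|^{ℓ₀}`), and gives the same class
(★ `valueSetMod_smul_xPlus_congr`).  The `hdich` of ★ p862003 on the whole axis column, deep and shallow orders alike.
[cite: Rogawski1990, §4.9 Prop. 4.9.1 (b) p. 55] [cite: Jacobowitz1962, §4] [cite: Serre1979, Ch. III §3 Prop. 7, Ch. V §3 Cor. 3] [cite: Kottwitz1986BaseChangeUnits, §1 pp. 240–241] -/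
theorem exists_fixed_unit_lineValueSet_axis_eq_smul_xPlus (hD : IsRamifiedQuadraticDatum σ ϖ d t) (jE : E →+* M) (hjiso : ∀ a, Valued.v (jE a) = Valued.v a)
    (hjfix : ∀ z, ρ z = z ↔ ∃ c, jE c = z) (hΘj : ∀ x, Θ (jE x) = jE (σ x))
    (hρρ : ∀ x, ρ (ρ x) = x) (hvρ : ∀ x, Valued.v (ρ x) = Valued.v x) (hΘΘ : ∀ x, Θ (Θ x) = x) (hΘρ : ∀ x, Θ (ρ x) = ρ (Θ x))
    (hvΘ : ∀ x, Valued.v (Θ x) = Valued.v x) (hα1 : Valued.v α ≤ 1) (hαρ : Valued.v (α - ρ α) = 1)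
    {κ : M} (hΘκ : Θ κ = κ) (hκρ : Valued.v (κ + ρ κ) ≤ 1) {j : ℕ} (hκj : Valued.v κ * Valued.v (jE ϖ) ^ j = 1)
    {lam : M} (hlam : Θ lam * lam = 1) {u₀ : E} {m k : ℕ} (hum : Valued.v (u₀ - 1) ≤ Valued.v (ϖ ^ m))
    (hlev : IsOrd ρ α (jE ϖ ^ j) ((lam - 1) / jE ϖ ^ (d % 2))) (hnlev : ¬ IsOrd ρ α (jE ϖ ^ j) ((lam - 1) / jE ϖ ^ (d % 2 + 1)))
    (hsq : IsOrd ρ α (jE ϖ ^ j) ((lam - 1) ^ 2 / jE ϖ ^ (2 * k)))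
    (hF1 : m ≤ k + d - 1) (hF2 : k ≤ m) (hF3 : m + d % 2 ≤ 2 * k) (hF4 : d % 2 + 1 ≤ k) (hF5 : m + d ≤ 2 * k + 1) (hF6 : 2 * k ≤ m + d) :
    ∃ e : E, σ e = e ∧ Valued.v e = 1 ∧
      {z : E | ∃ ζ : M, IsOrd ρ α (jE ϖ ^ j) ζ ∧
          Valued.v ((jE ϖ ^ m)⁻¹ * (jE z - (κ * (lam - jE u₀) * (ζ * Θ ζ) + ρ (κ * (lam - jE u₀) * (ζ * Θ ζ))))) ≤ 1} =
        valueSetMod σ ϖ m (e • xPlus σ ϖ d) := by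
  have hD' := hD
  obtain ⟨hσ, hvσ, hϖ, hfix, hd, h1d, ht⟩ := hD
  have hα : ρ α ≠ α := fun h => by rw [h, sub_self, map_zero] at hαρ; exact zero_ne_one hαρ
  have hq : Valued.v (jE ϖ) = exp (-1 : ℤ) := by rw [hjiso, hϖ]
  have hjv : ∀ c, Valued.v (jE c) ≤ 1 ↔ Valued.v c ≤ 1 := fun c => by rw [hjiso]
  have hcc1 : Valued.v (jE ϖ ^ j) ≤ 1 := by rw [v_map_varpi_pow hϖ jE hjiso j, ← exp_zero, exp_le_exp]; omega
  set c : M := κ * (lam - jE u₀) with hcdef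
  set S : M := c + ρ c with hSdef
  -- the scalar `s ∈ E` with `jE s = S`, its size and its trace
  obtain ⟨s, hs⟩ := (hjfix S).1 (map_add_map_eq hρρ c)
  have hvS : Valued.v S = exp (-((d % 2 : ℕ) : ℤ)) :=
    v_trace_depth_eq hD' jE hjiso hjfix hρρ hvρ hα1 hαρ hκρ hκj lam hum hlev hnlev hsq hF2 hF4
  have hvs : Valued.v s = exp (-((d % 2 : ℕ) : ℤ)) := by rw [← hjiso, hs, hvS]
  have htr : Valued.v (s + σ s) ≤ exp (-(2 * (k : ℤ))) := by
    rw [← hjiso, map_add, ← hΘj, hs]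
    exact v_trace_depth_add_map_le hD' jE hjiso hjfix hΘj hρρ hvρ hΘρ hvΘ hα1 hαρ hΘκ hκρ hκj hlam hum hlev hsq hF6
  -- a skew element `ϖ^m`-close to `s`
  obtain ⟨z', hz', hsz'⟩ := exists_skew_near_of_trace_deep hσ hfix hϖ hd ht (a := s) (s := -(s + σ s)) (by ring)
    (j := 2 * (k : ℤ)) (n := k) (m := m) (by rw [Valuation.map_neg]; exact htr) (by omega) (by omega)
  -- the reference scalar `t₊`
  set tp : E := (ϖ - σ ϖ) * ((ϖ * σ ϖ) ^ ((d - d % 2) / 2))⁻¹ with htpdef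
  have htp0 : tp ≠ 0 := refSkewScalar_ne_zero hvσ hϖ hd
  have hvtp : Valued.v tp = exp (-((d % 2 : ℕ) : ℤ)) := v_refSkewScalar hvσ hϖ hd
  have hσtp : σ tp = -tp := map_refSkewScalar_eq_neg hσ _
  -- `|z′| = |s|`
  have hvz' : Valued.v z' = Valued.v s := by
    have hlt : Valued.v (s - z') < Valued.v s := by
      rw [v_inv_varpi_pow_mul_le_one_iff hϖ] at hsz'
      rw [hvs]; refine lt_of_le_of_lt hsz' ?_; rw [exp_lt_exp]; omega
    have := Valuation.map_sub_eq_of_lt_left _ hlt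
    rw [sub_sub_cancel] at this
    exact this
  refine ⟨z' * tp⁻¹, ?_, ?_, ?_⟩
  · rw [map_mul, map_inv₀, hz', hσtp, inv_neg, neg_mul_neg]
  · rw [map_mul, map_inv₀, hvz', hvs, hvtp, ← exp_neg, ← exp_add]; simp
  -- the set identity: letter = ray of `S` = class of `s·t₊⁻¹` = class of `z′·t₊⁻¹`
  have hray := ray_eq_valueSetMod_smul_xPlus (ρ := ρ) (Θ := Θ) σ hvσ hϖ hd jE hjv hΘj hjfix c 0 hs m
  simp only [mul_zero, zero_add] at hray
  have hcongr : valueSetMod σ ϖ m ((s * tp⁻¹) • xPlus σ ϖ d) = valueSetMod σ ϖ m ((z' * tp⁻¹) • xPlus σ ϖ d) := by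
    refine valueSetMod_smul_xPlus_congr hvσ ϖ d m ?_
    have e : (s * tp⁻¹ - z' * tp⁻¹) * tp = s - z' := by field_simp
    rw [← htpdef, e]; exact hsz'
  rw [← hcongr, ← hray]
  ext z
  simp only [Set.mem_setOf_eq]
  constructor
  · rintro ⟨ζ, hζ, hz⟩
    obtain ⟨hB, hA⟩ := coords_fixed hρρ hα ζ
    obtain ⟨-, hA1⟩ := v_coords_le hα hα1 hcc1 hζ
    set A : M := ζ - (ζ - ρ ζ) / (α - ρ α) * α with hAdef
    obtain ⟨a, ha⟩ := (hjfix A).1 hA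
    refine ⟨a, by rw [← hjiso, ha]; exact hA1, ?_⟩
    have hest := v_value_sub_ray_le hD' jE hjiso hjfix hΘj hρρ hvρ hΘΘ hΘρ hvΘ hα1 hαρ hΘκ hκj hlam hum hnlev hsq hF1 hF2 hF3 hF4 hF6 hζ
    rw [← hAdef, ← ha, hΘj] at hest
    -- ray value `c·(jE a·Θ(jE a)) + ρ(…) = jE a·jE(σa)·S`
    have hrayval : c * (jE a * Θ (jE a)) + ρ (c * (jE a * Θ (jE a))) = jE a * jE (σ a) * (c + ρ c) := by
      have hρN : ρ (jE a * jE (σ a)) = jE a * jE (σ a) := by rw [map_mul, (hjfix _).2 ⟨a, rfl⟩, (hjfix _).2 ⟨σ a, rfl⟩]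
      rw [hΘj, show c * (jE a * jE (σ a)) = (jE a * jE (σ a)) * c by ring, map_mul ρ (jE a * jE (σ a)) c, hρN]; ring
    rw [hrayval]
    have e : (jE ϖ ^ m)⁻¹ * (jE z - jE a * jE (σ a) * (c + ρ c)) =
        (jE ϖ ^ m)⁻¹ * (jE z - (c * (ζ * Θ ζ) + ρ (c * (ζ * Θ ζ)))) + (jE ϖ ^ m)⁻¹ * ((c * (ζ * Θ ζ) + ρ (c * (ζ * Θ ζ))) - jE a * jE (σ a) * (c + ρ c)) := by ring
    rw [e]
    refine (Valuation.map_add _ _ _).trans (max_le hz ?_)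
    rw [v_inv_varpi_pow_mul_le_one_iff hq]
    exact hest
  · rintro ⟨a, ha, hz⟩
    exact ⟨jE a, isOrd_of_fixed ((hjfix _).2 ⟨a, rfl⟩) ((hjv a).2 ha), hz⟩

end LineModel

end Summit.HodgeConjecture.HodgeConjecture.Cruxes.H413.F0P3cDyRamAxisLetterEstimates

end
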